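import Literature.NumberTheory.EllipticCurves.HeckeCongruenceModulus
import Literature.NumberTheory.EllipticCurves.ModularCurve
import HarnessLib

/-!
# Pasten's spectral divisibility of the modular degree
# (Pasten 2024, Thm. 5.5 = Thm. 1.8, §3 p. 13; case `D = 1`, `M = N`)

Topic `NumberTheory/EllipticCurves`, over the Hecke-ring interface of
`HeckeCongruenceModulus.lean` (`anemicHeckeRing N k = 𝕋_{1,N} = ℤ[T_p : p ∤ N]`,
`eigenIdeal f = 𝕀_{[χ_f]}`, `heckeCongruenceModulus f P = η = #(𝕋 ⧸ (𝕀_{[χ_f]} + P))`) and the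
modular parametrisation data of `ModularCurve.lean` (`ModularParametrizationData W N`, with the
minimal-degree = optimal idiom of `abs_maninConstant_eq_one_of_isSemistable` /
`modularDegree_dvd_congruenceNumber`). Named facts only (D-0014); the proved companion results —
Prop. 5.4 in polynomial form, minimality of `eigenIdeal D.f` among the primes of `𝕋`, positivity of
every `heckeCongruenceModulus D.f P` for a minimal prime `P ≠ eigenIdeal D.f`, and integrality of
the eigenvalues of `D.f` — are in `PastenCongruenceModulusProofs.lean`, and the displayed size
estimate of the proof of Thm. 7.2 (p. 26), *"So we get
`log η_{[χ_{D,M}]}(c) < #c · (log N + 4 log N / log log N)`"*, is PROVED from Deligne's bound in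
weight `2` in `PastenCongruenceModulusSizeProofs.lean`
(`PastenShimura2024_log_heckeCongruenceModulus_lt_of_deligne`; formerly the separate named fact
`PastenShimura2024_log_heckeCongruenceModulus_lt` of this file, merged back into the proof
obligation of `pasten_thm_7_5_explicit` after the D-0027 review of 2026-08-15, its only unproved
input being the pre-existing named fact `Deligne1974_heckeT_eigenvalue_norm_le`).

Source: H. Pasten, *Shimura curves and the abc conjecture*, J. Number Theory 254 (2024) 214–335
= arXiv:1705.09251 [PastenShimura2024], read in the arXiv version: §3 p. 13, §4.9–4.11 p. 16,
§5.1–5.5 pp. 17–18 (Prop. 5.1, Prop. 5.4, Thm. 5.5 with its first proof), §7.2 p. 26 (Thm. 7.2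
and its proof). Throughout `D = 1`, `M = N`: the Shimura curve is the modular curve `X₀(N)`,
`𝕋_{1,N}` acts on `S₂(N) = S₂(Γ₀(N))` (§4.9–4.10), and (§5.1) `A` is an elliptic curve of
conductor `N` which is the optimal quotient `q : J₀(N) → A` attached to its (`ℤ`-valued) system of
Hecke eigenvalues `χ₀`, with modular degree `δ = δ_{1,N} = deg(X₀(N) → A)` (§3 p. 13).

## Contents

* `PastenShimura2024_thm_5_5` — Thm. 5.5 (= Thm. 1.8) for `D = 1`: *"The `(D,M)`-modular
  degree `δ` divides `∏_{[χ] ≠ [χ₀]} η_{[χ₀]}([χ])`. The product runs over all classes `[χ]` of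
  systems of Hecke eigenvalues on `𝕋_{D,M}` different to `[χ₀]`."*
* `PastenShimura2024_minimalDegree_le_163_mul` — §3 p. 13 (Mazur 1978, Kenku 1982): a minimal
  isogeny `A_{1,N} → E` has degree `≤ 163`, recorded as: the minimal parametrisation degree of any
  globally minimal curve of the class is `≤ 163 · δ_{1,N}`.

## Transcription notes

* *Classes of systems of Hecke eigenvalues ↔ minimal primes of `𝕋`.* `𝕋 ⊆ End_ℂ(S₂(Γ₀(N)))`
  acts faithfully and (§4.9) simultaneously diagonalisably, `S₂ = ⊕_χ V^χ`; so `⋂_χ ker χ = 0`,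
  the primes `ker χ = 𝕀_{[χ]}` (one per Galois class, §4.11: "All the elements of `[χ]` have the
  same kernel") are pairwise incomparable (each `𝕋 ⧸ 𝕀_{[χ]} ≅ χ(𝕋)` is an order in a number
  field) and are therefore exactly the minimal primes of `𝕋` (finitely many:
  `finite_minimalPrimes_anemicHeckeRing`; for the class of the curve this is the proved
  `ModularParametrizationData.eigenIdeal_mem_minimalPrimes`). Accordingly the product "over all
  classes `[χ] ≠ [χ₀]`" is recorded over `minimalPrimes (anemicHeckeRing N 2)` with
  `P ≠ eigenIdeal f` (the reading fixed in `HeckeCongruenceModulus.lean`), each factor being a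
  positive integer (`ModularParametrizationData.prod_heckeCongruenceModulus_pos`, proved), and `#c`
  as `Module.finrank ℤ (𝕋 ⧸ P)` (§4.11: `χ(𝕋)` "is an order in a totally real field of degree
  `#[χ]`").
* *`δ_{1,N}` and `χ₀` in the tree.* For an elliptic `W/ℚ` and a datum
  `D : ModularParametrizationData W N`, `D.f` is the newform of `W` at level `N` (= conductor);
  its system of eigenvalues on `𝕋` is Pasten's `χ₀` (`ℤ`-valued, `a_p(W)`:
  `ModularParametrizationData.hasIntegralEigenvalues_f`), `𝕀_{[χ₀]}` is `eigenIdeal D.f`, and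
  `η_{[χ₀]}([χ])` is `heckeCongruenceModulus D.f P`. Pasten's `A = A_{1,N}` is the `X₀(N)`-optimal
  curve of the isogeny class (`J₀(N)/𝕀_{[χ₀]}J₀(N)`, of dimension `#[χ₀] = 1`, §4.11) and
  `δ_{1,N} = deg(X₀(N) → A)` (§3 p. 13); as in `modularDegree_dvd_congruenceNumber` this is
  `D.modularDegree` for a datum `D` of minimal degree among all data at level `N`, of all elliptic
  `W'`, with the same newform (every parametrisation in the class factors through the optimal one).
* *`#c` and `N ≥ 11` in the size estimate* (`PastenCongruenceModulusSizeProofs.lean`): `#c`, the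
  number of systems in the class `c` = the degree of the number field generated by the values of
  any `χ ∈ c` (§4.11: `χ(𝕋)` "is an order in a totally real field of degree `#[χ]`"), is
  `Module.finrank ℤ (𝕋 ⧸ P)`; `N ≥ 11` (Pasten, proof of Cor. 5.3: "as `N ≥ 11`", conductors of
  elliptic curves; it makes `log log N > 0`) is automatic for a level carrying a datum.
* Not here: the size estimate `log η_{[χ₀]}(c) < #c (log N + 4 log N / log log N)` (proved from
  Deligne's bound in `PastenCongruenceModulusSizeProofs.lean`, see above), Thm. 7.2 itself
  (`log δ_{1,N} ≤ (N/12 + 7d(N²)/12)(log N + 4 log N / log log N)`, which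
  also needs Prop. 7.1, `r_{1,N} = dim S₂(N)`), Cor. 5.3, the second proof of Thm. 5.5 (Lemma 5.6,
  `δ` as the denominator of the projector `π₀`), the case `D > 1` (no Shimura curves `X₀^D(M)` in
  the tree), and the height comparison `h(E) ≤ ½ log δ_{1,N} + 9` of §3 (no Faltings height in
  the tree).

## References

* H. Pasten, *Shimura curves and the abc conjecture*, J. Number Theory 254 (2024), 214–335,
  doi:10.1016/j.jnt.2023.07.002 = arXiv:1705.09251: Thm. 1.8 (p. 7), §3 (p. 13), §4.9–4.11
  (p. 16), §5.1–5.5 (pp. 17–18: Prop. 5.1, Prop. 5.4, Thm. 5.5), §7.2 (p. 26: Thm. 7.2 and its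
  proof). [PastenShimura2024]
* M. A. Kenku, *On the number of ℚ-isomorphism classes of elliptic curves in each ℚ-isogeny
  class*, J. Number Theory 15 (1982), 199–202. [Kenku1982]
* B. Mazur, *Rational isogenies of prime degree*, Invent. Math. 44 (1978), 129–162. [Mazur1978]
-/

noncomputable section

open scoped MatrixGroups ModularForm

open CongruenceSubgroup

namespace Literature.NumberTheory.EllipticCurves.ModularForms

/-! ### Thm. 5.5 and the Mazur–Kenku comparison (named facts) -/

section Facts

/-- **Pasten 2024, Theorem 5.5 (= Theorem 1.8), classical case `D = 1`, `M = N`: the modular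
degree divides the product of the congruence moduli.** *"The `(D,M)`-modular degree `δ` divides
`∏_{[χ] ≠ [χ₀]} η_{[χ₀]}([χ])`. The product runs over all classes `[χ]` of systems of Hecke
eigenvalues on `𝕋_{D,M}` different to `[χ₀]`."* Setting (§5.1): `A` an elliptic curve of conductor
`N`, the optimal quotient of `J₀(N)` attached to its `ℤ`-valued system `χ₀`, `δ = δ_{1,N} =
deg(X₀(N) → A)` (§3 p. 13), `η_{[χ₀]}([χ]) = [ℤ·f : 𝕀_{[χ]}·f]` (§5.4). Recorded over the tree:
for an elliptic `W/ℚ` and a datum `D` at level `N` of minimal degree among all data at level `N`, of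
all elliptic `W'/ℚ`, with the same newform (so `D.modularDegree = δ_{1,N}`), `D.modularDegree`
divides the product of `heckeCongruenceModulus D.f P` over the minimal primes `P ≠ eigenIdeal D.f`
of `𝕋 = anemicHeckeRing N 2` (= the kernels `𝕀_{[χ]}` of the classes `[χ] ≠ [χ₀]`, module
docstring). [cite: PastenShimura2024, Thm. 5.5 p. 18 (= Thm. 1.8)] -/
def PastenShimura2024_thm_5_5 : Prop :=
  ∀ (N : ℕ) [NeZero N] (W : WeierstrassCurve ℚ) [W.IsElliptic] (D : ModularParametrizationData W N),
    (∀ (W' : WeierstrassCurve ℚ) [W'.IsElliptic] (D' : ModularParametrizationData W' N),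
        D'.f = D.f → D.modularDegree ≤ D'.modularDegree) →
      D.modularDegree ∣
        ∏ P ∈ ((finite_minimalPrimes_anemicHeckeRing N 2).toFinset.erase (eigenIdeal D.f)),
          heckeCongruenceModulus D.f P

/-- **The minimal parametrisation degree within an isogeny class is at most `163 · δ_{1,N}`**
(Pasten 2024, §3 p. 13: *"The degree of a minimal isogeny between `A_{1,N}` and `E` is uniformly
bounded by `163` thanks to Mazur [Mazur 1978] and Kenku [Kenku 1982]"*; every modular
parametrisation `X₀(N) → E` factors through the optimal one `X₀(N) → A_{1,N}` followed by an
isogeny `A_{1,N} → E`, and composing the optimal parametrisation with a minimal isogeny `ψ` gives a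
parametrisation of `E` of degree `deg ψ · δ_{1,N} ≤ 163 · δ_{1,N}`, whose pull-back of the Néron
differential is an integer multiple of `2πi f dτ` — for a *globally minimal* model of `E`, whose
datum lattice is the Néron lattice, by the Néron mapping property for `ψ` and the integrality of
the Manin constant of `A_{1,N}`). Recorded over the tree: if `D` is a datum of minimal degree in the
class at level `N` (`D.modularDegree = δ_{1,N}`) and `D'` is a datum of a globally minimal elliptic
`W'` with the same newform which is of minimal degree among the data of `W'` itself, then
`D'.modularDegree ≤ 163 · D.modularDegree`. (Global minimality of `W'` matters: the data of a
non-minimal model rescale the lattice and may exclude the composite parametrisation.) The bound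
`163` is the largest degree of a rational cyclic isogeny (Mazur 1978; Kenku 1982).
[cite: PastenShimura2024, §3 p. 13] [cite: Kenku1982] [cite: Mazur1978] -/
def PastenShimura2024_minimalDegree_le_163_mul : Prop :=
  ∀ (N : ℕ) [NeZero N] (W W' : WeierstrassCurve ℚ) [W.IsElliptic] [W'.IsElliptic]
    [W'.IsGloballyMinimal]
    (D : ModularParametrizationData W N) (D' : ModularParametrizationData W' N),
    D'.f = D.f →
      (∀ (W'' : WeierstrassCurve ℚ) [W''.IsElliptic] (D'' : ModularParametrizationData W'' N),
          D''.f = D.f → D.modularDegree ≤ D''.modularDegree) →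
        (∀ D'' : ModularParametrizationData W' N, D'.modularDegree ≤ D''.modularDegree) →
          D'.modularDegree ≤ 163 * D.modularDegree

end Facts

end Literature.NumberTheory.EllipticCurves.ModularForms

end
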